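import Summits.KontsevichZagierPeriods.Zeta5Search.LaiSweepShard

/-!
# `κ₃` sweep certificate — shard file 001 of 127 (shards 7–13 of 889)

HONEST FRAMING. Systematic search; no irrationality claim unless certified. This file only checks,
by `decide +kernel`, shards 7–13 of the order-cell sweep of the `κ₃` point `(74, 2180, 444; δ74)`
(engine `LaiSweepEngine`, soundness `LaiSweepJump/Free/Eval/Shard/Kappa3`; a shard is `⟨regime, n,
p, q, p', q', Lo, Up⟩`: `n` cells from `p/q` to `p'/q'` with integer rate sums in `[Lo, Up]`, `K =
128`, `D = 2^40`). It draws NO conclusion: only the capstone `LaiKappa3SweepCert`, which needs all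
127 shard files, does. Kernel cost of this file ≈ 560 cells × 0.3 s.
-/

namespace Summit.KontsevichZagierPeriods.Zeta5Search.Sweep

set_option maxHeartbeats 100000000 in
/-- Shard 7: 80 cells of regime A from `1/259` to `1/246`.
[cite: Lai2024BallRivoal, §4 Lemma 4.3] -/
theorem shard007 :
    Shard.check 128 (2^40)
      ⟨false, 80, 1, 259, 1, 246, 358887190511554, 359158645579977⟩ = true := by
  decide +kernel

set_option maxHeartbeats 100000000 in
/-- Shard 8: 80 cells of regime A from `1/246` to `11/2548`.
[cite: Lai2024BallRivoal, §4 Lemma 4.3] -/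
theorem shard008 :
    Shard.check 128 (2^40)
      ⟨false, 80, 1, 246, 11, 2548, 358051175734423, 358567568194617⟩ = true := by
  decide +kernel

set_option maxHeartbeats 100000000 in
/-- Shard 9: 80 cells of regime A from `11/2548` to `10/2189`.
[cite: Lai2024BallRivoal, §4 Lemma 4.3] -/
theorem shard009 :
    Shard.check 128 (2^40)
      ⟨false, 80, 11, 2548, 10, 2189, 305042396725395, 305280754031961⟩ = true := by
  decide +kernel

set_option maxHeartbeats 100000000 in
/-- Shard 10: 80 cells of regime A from `10/2189` to `11/2282`.
[cite: Lai2024BallRivoal, §4 Lemma 4.3] -/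
theorem shard010 :
    Shard.check 128 (2^40)
      ⟨false, 80, 10, 2189, 11, 2282, 420225002275827, 420574804700046⟩ = true := by
  decide +kernel

set_option maxHeartbeats 100000000 in
/-- Shard 11: 80 cells of regime A from `11/2282` to `11/2196`.
[cite: Lai2024BallRivoal, §4 Lemma 4.3] -/
theorem shard011 :
    Shard.check 128 (2^40)
      ⟨false, 80, 11, 2282, 11, 2196, 395040060659694, 395306111620428⟩ = true := by
  decide +kernel

set_option maxHeartbeats 100000000 in
/-- Shard 12: 80 cells of regime A from `11/2196` to `6/1135`.
[cite: Lai2024BallRivoal, §4 Lemma 4.3] -/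
theorem shard012 :
    Shard.check 128 (2^40)
      ⟨false, 80, 11, 2196, 6, 1135, 618844464195466, 619435312061737⟩ = true := by
  decide +kernel

set_option maxHeartbeats 100000000 in
/-- Shard 13: 80 cells of regime A from `6/1135` to `4/731`.
[cite: Lai2024BallRivoal, §4 Lemma 4.3] -/
theorem shard013 :
    Shard.check 128 (2^40)
      ⟨false, 80, 6, 1135, 4, 731, 418954762909328, 419196637759926⟩ = true := by
  decide +kernel

/-- The checked shards of this file, in order. [folklore] -/
def shards001 : List (CheckedShard 128 (2^40)) :=
  [⟨_, shard007⟩, ⟨_, shard008⟩, ⟨_, shard009⟩, ⟨_, shard010⟩, ⟨_, shard011⟩,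
    ⟨_, shard012⟩, ⟨_, shard013⟩]

end Summit.KontsevichZagierPeriods.Zeta5Search.Sweep
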